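import Mathlib
import Summits.AtomisticToContinuum.Crystallization.Theorems.ExcessDecayLiouvilleFineGrainsFlatComparison

/-!
# The boundary weight of a ball in a separated set is a surface term

Helper for the crux `GappedShellCensus.CleanLimitsHaveWindows` (stmt-AtomisticToContinuum-15932), line
`Sketch`, stub `stub_ballBoundarySum`. For a `δ`-separated set `Z ⊆ ℝ³`, a centre `c`, a radius `L ≥ 1`
such that some point of `Z` lies outside `closedBall c L`, and `W = Z ∩ closedBall c L`:
`Σ_{p ∈ W} (1 + infDist p (Z ∖ W))⁻¹ ^ 3 ≤ C(δ) L²`. Proof: a point `p ∈ W` at depth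
`s = L − dist p c ≥ 0` has `infDist p (Z ∖ W) ≥ s` (every point of `Z ∖ W` is farther than `L` from `c`),
so its weight is `≤ (1 + ⌊s⌋)⁻¹ ^ 3`; the depth shell `⌊s⌋ = k` (`k ≤ L`) holds
`≤ 24(1+δ)(L − k + δ/2)²/δ³ ≤ 24(1+δ)(L + δ/2)²/δ³` points (`card_shell_le`), and
`Σ_k (1 + k)⁻¹ ^ 3 ≤ 1 + Σ_{k ≥ 1} k⁻² ≤ 3` (`sum_Ioo_inv_sq_le`). All `[folklore]`.
-/

noncomputable section

namespace Summit.AtomisticToContinuum.Crystallization.Theorems.CleanHull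

open Metric
open Summit.AtomisticToContinuum.Crystallization.Theorems.ExcessDecayLiouvilleFineGrains

/-- **Stub T3b-i (the boundary weight of a ball is `O(L²)`).** For every `δ > 0` there is `C` such that
for every `δ`-separated `Z ⊆ ℝ³`, every centre `c` and radius `L ≥ 1` with a point of `Z` outside
`closedBall c L`, and `W = Z ∩ closedBall c L`: `Σ_{p ∈ W} (1 + infDist p (Z ∖ W))⁻¹ ^ 3 ≤ C L²`
(depth `s` gives `infDist ≥ s`; the depth shells `⌊s⌋ = k` are counted by `card_shell_le`;
`Σ_k (1 + k)⁻¹ ^ 3 ≤ 3`). [folklore] -/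
theorem stub_ballBoundarySum (δ : ℝ) (hδ : 0 < δ) : ∃ C : ℝ, ∀ Z : Set (EuclideanSpace ℝ (Fin 3)),
    (∀ p ∈ Z, ∀ q ∈ Z, p ≠ q → δ ≤ dist p q) →
    ∀ (c : EuclideanSpace ℝ (Fin 3)) (L : ℝ), 1 ≤ L → (∃ q ∈ Z, L < dist q c) →
      ∀ W : Finset (EuclideanSpace ℝ (Fin 3)), (↑W : Set (EuclideanSpace ℝ (Fin 3))) = Z ∩ Metric.closedBall c L →
        ∑ p ∈ W, (1 + Metric.infDist p (Z \ (↑W : Set (EuclideanSpace ℝ (Fin 3)))))⁻¹ ^ 3 ≤ C * L ^ 2 := by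
  refine ⟨24 * (1 + δ) * (1 + δ / 2) ^ 2 / δ ^ 3 * 3, ?_⟩
  intro Z hsep c L hL hout W hW
  -- membership in `W` and in `Z \ W`
  have hmemW : ∀ p, p ∈ W ↔ p ∈ Z ∧ dist p c ≤ L := fun p => by
    rw [← Finset.mem_coe, hW, Set.mem_inter_iff, Metric.mem_closedBall]
  have hZW : ∀ y, y ∈ Z \ (↑W : Set (EuclideanSpace ℝ (Fin 3))) ↔ y ∈ Z ∧ L < dist y c := by
    intro y
    rw [Set.mem_sdiff, Finset.mem_coe, hmemW]
    constructor
    · rintro ⟨hy, hy'⟩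
      exact ⟨hy, not_le.1 fun h => hy' ⟨hy, h⟩⟩
    · rintro ⟨hy, hy'⟩
      exact ⟨hy, fun h => (not_le.2 hy') h.2⟩
  obtain ⟨q, hqZ, hqL⟩ := hout
  have hne : (Z \ (↑W : Set (EuclideanSpace ℝ (Fin 3)))).Nonempty := ⟨q, (hZW q).2 ⟨hqZ, hqL⟩⟩
  -- depth shells `⌊L - dist p c⌋ = k`
  set m : EuclideanSpace ℝ (Fin 3) → ℕ := fun p => ⌊L - dist p c⌋₊ with hm
  have hfloor : ∀ p ∈ W, ((m p : ℕ) : ℝ) ≤ L - dist p c ∧ L - dist p c < (m p : ℕ) + 1 :=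
    fun p hp => ⟨Nat.floor_le (by linarith [((hmemW p).1 hp).2]), Nat.lt_floor_add_one _⟩
  -- (1) termwise bound: the exterior is at distance `≥ ⌊depth⌋`
  have term : ∀ p ∈ W, (1 + infDist p (Z \ (↑W : Set (EuclideanSpace ℝ (Fin 3)))))⁻¹ ^ 3 ≤
      (1 + (m p : ℝ))⁻¹ ^ 3 := by
    intro p hp
    have hdepth : (m p : ℝ) ≤ infDist p (Z \ (↑W : Set (EuclideanSpace ℝ (Fin 3)))) := by
      refine (le_infDist hne).2 fun y hy => ?_
      obtain ⟨-, hyL⟩ := (hZW y).1 hy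
      linarith [(hfloor p hp).1, dist_triangle y p c, dist_comm y p]
    have h0 : (0 : ℝ) < 1 + (m p : ℝ) := by positivity
    exact pow_le_pow_left₀
      (inv_nonneg.2 (by linarith [infDist_nonneg (x := p) (s := Z \ (↑W : Set _))]))
      (inv_anti₀ h0 (by linarith)) 3
  -- (2) regroup by shells
  set t := W.image m with ht
  have hmaps : ∀ p ∈ W, m p ∈ t := fun p hp => Finset.mem_image_of_mem m hp
  have step2 : ∑ p ∈ W, (1 + (m p : ℝ))⁻¹ ^ 3 =
      ∑ k ∈ t, ((W.filter fun p => m p = k).card : ℝ) * ((1 + (k : ℝ))⁻¹ ^ 3) := by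
    have := Finset.sum_fiberwise_of_maps_to' hmaps (f := fun k : ℕ => (1 + (k : ℝ))⁻¹ ^ 3)
    simp only [Finset.sum_const, nsmul_eq_mul] at this
    exact this.symm
  -- (3) count each shell
  have step3 : ∀ k ∈ t, ((W.filter fun p => m p = k).card : ℝ) ≤
      24 * (1 + δ) * (L + δ / 2) ^ 2 / δ ^ 3 := by
    intro k hk
    obtain ⟨p₀, hp₀, hp₀k⟩ := Finset.mem_image.1 hk
    have hkL : (k : ℝ) ≤ L := by
      have h1 := (hfloor p₀ hp₀).1
      rw [hp₀k] at h1
      linarith [dist_nonneg (x := p₀) (y := c)]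
    have := card_shell_le (W.filter fun p => m p = k) c hδ (b := L - k) (by linarith) ?_ ?_
    · refine this.trans ?_
      rw [div_le_div_iff_of_pos_right (by positivity)]
      exact mul_le_mul_of_nonneg_left (pow_le_pow_left₀ (by linarith)
        (by linarith [(Nat.cast_nonneg k : (0 : ℝ) ≤ k)]) 2) (by positivity)
    · intro a ha
      obtain ⟨haW, hak⟩ := Finset.mem_filter.1 ha
      obtain ⟨h1, h2⟩ := hfloor a haW
      rw [hak] at h1 h2
      constructor <;> linarith
    · intro a ha a' ha' haa'
      exact hsep a ((hmemW a).1 (Finset.mem_filter.1 ha).1).1 a'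
        ((hmemW a').1 (Finset.mem_filter.1 ha').1).1 haa'
  -- (4) `Σ_k (1 + k)⁻¹ ^ 3 ≤ 3`
  have step4 : ∑ k ∈ t, (1 + (k : ℝ))⁻¹ ^ 3 ≤ 3 := by
    have hsub : t ⊆ insert 0 (Finset.Ioo 0 (t.sup id + 1)) := by
      intro k hk
      rw [Finset.mem_insert, Finset.mem_Ioo]
      rcases Nat.eq_zero_or_pos k with h | h
      · exact Or.inl h
      · exact Or.inr ⟨h, Nat.lt_succ_of_le (Finset.le_sup (f := id) hk)⟩
    have hIoo : ∀ k ∈ Finset.Ioo 0 (t.sup id + 1), (1 + (k : ℝ))⁻¹ ^ 3 ≤ ((k : ℝ) ^ 2)⁻¹ := by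
      intro k hk
      have hk1 : (1 : ℝ) ≤ k := by exact_mod_cast (Finset.mem_Ioo.1 hk).1
      calc (1 + (k : ℝ))⁻¹ ^ 3 ≤ ((k : ℝ)⁻¹) ^ 3 :=
            pow_le_pow_left₀ (by positivity) (inv_anti₀ (by linarith) (by linarith)) 3
        _ ≤ ((k : ℝ)⁻¹) ^ 2 :=
            pow_le_pow_of_le_one (by positivity) (inv_le_one_of_one_le₀ hk1) (by norm_num)
        _ = ((k : ℝ) ^ 2)⁻¹ := by rw [inv_pow]
    have h2 : ∑ k ∈ Finset.Ioo 0 (t.sup id + 1), ((k : ℝ) ^ 2)⁻¹ ≤ 2 := by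
      simpa using sum_Ioo_inv_sq_le (α := ℝ) 0 (t.sup id + 1)
    calc ∑ k ∈ t, (1 + (k : ℝ))⁻¹ ^ 3
        ≤ ∑ k ∈ insert 0 (Finset.Ioo 0 (t.sup id + 1)), (1 + (k : ℝ))⁻¹ ^ 3 :=
          Finset.sum_le_sum_of_subset_of_nonneg hsub fun k _ _ => by positivity
      _ = (1 + ((0 : ℕ) : ℝ))⁻¹ ^ 3 +
            ∑ k ∈ Finset.Ioo 0 (t.sup id + 1), (1 + (k : ℝ))⁻¹ ^ 3 :=
          Finset.sum_insert (by simp)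
      _ ≤ 1 + ∑ k ∈ Finset.Ioo 0 (t.sup id + 1), ((k : ℝ) ^ 2)⁻¹ :=
          add_le_add (by norm_num) (Finset.sum_le_sum hIoo)
      _ ≤ 3 := by linarith
  -- (5) assembly
  have hL2 : (L + δ / 2) ^ 2 ≤ (1 + δ / 2) ^ 2 * L ^ 2 := by
    rw [← mul_pow]
    exact pow_le_pow_left₀ (by positivity) (by nlinarith) 2
  calc ∑ p ∈ W, (1 + infDist p (Z \ (↑W : Set (EuclideanSpace ℝ (Fin 3)))))⁻¹ ^ 3
      ≤ ∑ p ∈ W, (1 + (m p : ℝ))⁻¹ ^ 3 := Finset.sum_le_sum term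
    _ = ∑ k ∈ t, ((W.filter fun p => m p = k).card : ℝ) * ((1 + (k : ℝ))⁻¹ ^ 3) := step2
    _ ≤ ∑ k ∈ t, (24 * (1 + δ) * (L + δ / 2) ^ 2 / δ ^ 3) * ((1 + (k : ℝ))⁻¹ ^ 3) :=
        Finset.sum_le_sum fun k hk => mul_le_mul_of_nonneg_right (step3 k hk) (by positivity)
    _ ≤ (24 * (1 + δ) * (L + δ / 2) ^ 2 / δ ^ 3) * 3 := by
        rw [← Finset.mul_sum]
        exact mul_le_mul_of_nonneg_left step4 (by positivity)
    _ ≤ (24 * (1 + δ) * ((1 + δ / 2) ^ 2 * L ^ 2) / δ ^ 3) * 3 := by gcongr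
    _ = _ := by ring

end Summit.AtomisticToContinuum.Crystallization.Theorems.CleanHull

end
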